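import Literature.Topology.FourManifolds.LefschetzBaseShadow
import Literature.AlgebraicTopology.SingularHomology.CircleIntegralCocycle
import Mathlib.Analysis.SpecialFunctions.SmoothTransition
import HarnessLib

/-!
# The standard Lefschetz base of genus `g`, XIV: the `2g` circle-valued maps of the Milnor cover

Topic `Literature/Topology/FourManifolds`; namespace `Literature.Topology.FourManifolds.LefschetzBase`.
The Čech / Mayer–Vietoris description of `H¹(Base g; ℤ) = Hom(H₁(Base g), ℤ) = ℤ^{2g}` by MAPS TO
THE CIRCLE (Bott–Tu 1982, §2: proof of Prop. 2.3 and the explicit coboundary operator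
`δ : H⁰(U ∩ V) → H¹(U ∪ V)` described after it — the coboundary of a locally constant function `f`
is `d(ρ_V f)` on `U`, `−d(ρ_U f)` on `V`; Hatcher 2002, §3.1 p. 198 and §2.2 p. 150): for the Milnor cover
`Base g = U ∪ V` (`LefschetzBaseCover*.lean`: `U = {Re x^{2g+1} > −3/8}`, `V = {Re x^{2g+1} < −1/4}`)
and the clopen subsets `C_j ⊆ U ∩ V` (`Cset g j`: upper sheet, sector `≤ j`;
`LefschetzBaseShadowLoops.lean`) we write down

* `rhoV` — a smooth function with `rhoV = 1` on `{Re x^{2g+1} ≤ −0.35} ⊇ V ∖ U` and `rhoV = 0` on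
  `{Re x^{2g+1} ≥ −0.27} ⊇ U ∖ V` (so `(1 − rhoV, rhoV)` is a smooth partition of unity subordinate
  to `(U, V)`), from Mathlib's `Real.smoothTransition`;
* `chiC g j` — the indicator of `C_j`, extended by `0` off `U ∩ V`; locally constant on `U ∩ V`;
* the REAL LIFTS `FU g j = rhoV · chiC` (smooth on `U`) and `FV g j = (rhoV − 1) · chiC` (smooth
  on `V`), with `FU − FV = chiC ∈ {0, 1}`;
* **`phi g j : C(Base g, ℝ/ℤ)`**, `phi = FU mod 1` on `U` and `phi = FV mod 1` on `V`
  (`phi_eq_coe_FU`, `phi_eq_coe_FV`): the circle-valued map whose class is the Mayer–Vietoris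
  coboundary of `1_{C_j}`; its local lifts are smooth (`contMDiffOn_FU`, `contMDiffOn_FV`), so
  `d(lift)` is a closed `1`-form on the base.

Sequel (`LefschetzBaseCircleMapsWinding.lean`): the winding of `phi g j` along the `i`-th chain loop
is `−δ_ij`, so a loop with non-zero homology shadow winds non-trivially around some `phi g j` — the
de Rham form of "the vanishing cycle is homologically non-trivial" used by the Legendrian
realisation step of `Literature.Geometry.Symplectic.palf_stein_supportedByBoundaryOpenBook`.
Everything here is proved; only definitions and theorems.

## References
* R. Bott, L. W. Tu, *Differential Forms in Algebraic Topology*, GTM 82 (1982), §2, Prop. 2.3 and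
  the explicit coboundary operator after its proof (the Mayer–Vietoris sequence). [BottTu1982Forms]
* A. Hatcher, *Algebraic Topology*, CUP 2002, §2.2 p. 150, §3.1 p. 198. [HatcherAT2002]
* J. Milnor, *Singular points of complex hypersurfaces* (1968), §9 Lemma 9.2 (the cover). [Milnor1968]
-/

noncomputable section

open scoped Manifold ContDiff Topology
open Set Function Filter
open Literature.AlgebraicTopology.SingularHomology

namespace Literature.Topology.FourManifolds

/-- Local notation: `𝔼 n` is the model Euclidean space `EuclideanSpace ℝ (Fin n)`. -/
local notation "𝔼 " n:arg => EuclideanSpace ℝ (Fin n)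

namespace LefschetzBase

variable {g : ℕ}

/-! ### The real part of `x^{2g+1}` and the partition of unity -/

/-- `Re x^{2g+1}` on the base (the function defining the Milnor cover). [cite: Milnor1968, §9 Lemma 9.2] -/
def rePow (p : Base g) : ℝ := (cx p.1 ^ (2 * g + 1)).re

/-- `Re x^{2g+1}` is smooth on `ℂ²`. [folklore] -/
theorem contDiff_rePow_ambient (n : ℕ) : ContDiff ℝ ∞ fun q : 𝔼 4 => (cx q ^ n).re :=
  show ContDiff ℝ ∞ fun q : 𝔼 4 => Complex.reCLM (cx q ^ n) from
    Complex.reCLM.contDiff.comp (contDiff_cx.pow n)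

/-- `Re x^{2g+1}` is smooth on the base (a manifold with boundary). [folklore] -/
theorem contMDiff_rePow (g : ℕ) : ContMDiff (𝓡∂ 4) 𝓘(ℝ, ℝ) ∞ (rePow (g := g)) :=
  (contDiff_rePow_ambient (2 * g + 1)).contMDiff.comp
    (RegularSublevel.contMDiff_incl (isRegularLevel_rho g))

/-- `Re x^{2g+1}` is continuous on the base. [folklore] -/
theorem continuous_rePow (g : ℕ) : Continuous (rePow (g := g)) :=
  (contMDiff_rePow g).continuous

/-- Membership in `U` through `rePow`. [folklore] -/
theorem mem_coverU_iff (p : Base g) : p ∈ coverU g ↔ -(3 / 8 : ℝ) < rePow p := Iff.rfl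

/-- Membership in `V` through `rePow`. [folklore] -/
theorem mem_coverV_iff (p : Base g) : p ∈ coverV g ↔ rePow p < -(1 / 4 : ℝ) := Iff.rfl

/-- **The bump `rhoV`**: `1` where `Re x^{2g+1} ≤ −0.35`, `0` where `Re x^{2g+1} ≥ −0.27`, smooth.
[cite: BottTu1982Forms, §2 Prop. 2.3] -/
def rhoV (p : Base g) : ℝ := Real.smoothTransition ((-(27 / 100 : ℝ) - rePow p) / (8 / 100))

/-- `rhoV` is smooth. [folklore] -/
theorem contMDiff_rhoV (g : ℕ) : ContMDiff (𝓡∂ 4) 𝓘(ℝ, ℝ) ∞ (rhoV (g := g)) :=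
  Real.smoothTransition.contDiff.comp_contMDiff
    (((contMDiff_const (c := -(27 / 100 : ℝ))).sub (contMDiff_rePow g)).div_const _)

/-- `rhoV` is continuous. [folklore] -/
theorem continuous_rhoV (g : ℕ) : Continuous (rhoV (g := g)) := (contMDiff_rhoV g).continuous

/-- `rhoV = 0` where `Re x^{2g+1} ≥ −0.27` (in particular on `U ∖ V`). [folklore] -/
theorem rhoV_eq_zero {p : Base g} (hp : -(27 / 100 : ℝ) ≤ rePow p) : rhoV p = 0 :=
  Real.smoothTransition.zero_of_nonpos (div_nonpos_of_nonpos_of_nonneg (by linarith) (by norm_num))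

/-- `rhoV = 1` where `Re x^{2g+1} ≤ −0.35` (in particular on `V ∖ U`). [folklore] -/
theorem rhoV_eq_one {p : Base g} (hp : rePow p ≤ -(35 / 100 : ℝ)) : rhoV p = 1 :=
  Real.smoothTransition.one_of_one_le (by rw [le_div_iff₀ (by norm_num : (0 : ℝ) < 8 / 100)]; linarith)

/-! ### The indicator of the clopen set `C_j` -/

/-- **The indicator `chiC g j` of `C_j ⊆ U ∩ V`**, extended by `0` off `U ∩ V`. [cite: BottTu1982Forms, §2 Prop. 2.3] -/
def chiC (g j : ℕ) (p : Base g) : ℝ := by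
  classical
  exact if h : p ∈ coverU g ∩ coverV g then (Cset g j).indicator (fun _ => (1 : ℝ)) ⟨p, h⟩ else 0

/-- On `U ∩ V`, `chiC` is the indicator of `C_j`. [folklore] -/
theorem chiC_of_mem (j : ℕ) {p : Base g} (h : p ∈ coverU g ∩ coverV g) :
    chiC g j p = (Cset g j).indicator (fun _ => (1 : ℝ)) ⟨p, h⟩ := by
  classical
  exact dif_pos h

/-- `chiC = 1` at the points of `C_j`. [folklore] -/
theorem chiC_eq_one (j : ℕ) {p : Base g} (h : p ∈ coverU g ∩ coverV g) (hC : ⟨p, h⟩ ∈ Cset g j) :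
    chiC g j p = 1 := by
  rw [chiC_of_mem j h, indicator_of_mem hC]

/-- `chiC = 0` at the points of `(U ∩ V) ∖ C_j`. [folklore] -/
theorem chiC_eq_zero (j : ℕ) {p : Base g} (h : p ∈ coverU g ∩ coverV g) (hC : ⟨p, h⟩ ∉ Cset g j) :
    chiC g j p = 0 := by
  rw [chiC_of_mem j h, indicator_of_notMem hC]

/-- `chiC = 0` off `U ∩ V`. [folklore] -/
theorem chiC_of_not_mem (j : ℕ) {p : Base g} (h : p ∉ coverU g ∩ coverV g) : chiC g j p = 0 := by
  classical
  exact dif_neg h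

/-- `chiC` takes the values `0` and `1` only. [folklore] -/
theorem chiC_eq_zero_or_one (j : ℕ) (p : Base g) : chiC g j p = 0 ∨ chiC g j p = 1 := by
  by_cases h : p ∈ coverU g ∩ coverV g
  · by_cases hC : (⟨p, h⟩ : ↥(coverU g ∩ coverV g)) ∈ Cset g j
    · exact Or.inr (chiC_eq_one j h hC)
    · exact Or.inl (chiC_eq_zero j h hC)
  · exact Or.inl (chiC_of_not_mem j h)

/-- `chiC` is an integer. [folklore] -/
theorem exists_int_chiC (j : ℕ) (p : Base g) : ∃ k : ℤ, chiC g j p = k := by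
  rcases chiC_eq_zero_or_one j p with h | h
  · exact ⟨0, by rw [h, Int.cast_zero]⟩
  · exact ⟨1, by rw [h, Int.cast_one]⟩

/-- **`chiC` is locally constant on `U ∩ V`** (`C_j` is clopen there). [folklore] -/
theorem eventually_chiC_eq (j : ℕ) {p : Base g} (h : p ∈ coverU g ∩ coverV g) :
    chiC g j =ᶠ[𝓝 p] fun _ => chiC g j p := by
  have hUV : IsOpen (coverU g ∩ coverV g) := (isOpen_coverU g).inter (isOpen_coverV g)
  by_cases hC : (⟨p, h⟩ : ↥(coverU g ∩ coverV g)) ∈ Cset g j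
  · obtain ⟨O, hO, hOC⟩ := isOpen_induced_iff.1 (isClopen_Cset (g := g) j).isOpen
    have hpO : p ∈ O := by
      have : (⟨p, h⟩ : ↥(coverU g ∩ coverV g)) ∈ Subtype.val ⁻¹' O := by rw [hOC]; exact hC
      exact this
    filter_upwards [hO.mem_nhds hpO, hUV.mem_nhds h] with q hqO hq
    have hqC : (⟨q, hq⟩ : ↥(coverU g ∩ coverV g)) ∈ Cset g j := by
      rw [← hOC]; exact hqO
    rw [chiC_eq_one j hq hqC, chiC_eq_one j h hC]
  · obtain ⟨O, hO, hOC⟩ := isOpen_induced_iff.1 (isClopen_Cset (g := g) j).compl.isOpen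
    have hpO : p ∈ O := by
      have : (⟨p, h⟩ : ↥(coverU g ∩ coverV g)) ∈ Subtype.val ⁻¹' O := by rw [hOC]; exact hC
      exact this
    filter_upwards [hO.mem_nhds hpO, hUV.mem_nhds h] with q hqO hq
    have hqC : (⟨q, hq⟩ : ↥(coverU g ∩ coverV g)) ∉ Cset g j := by
      show (⟨q, hq⟩ : ↥(coverU g ∩ coverV g)) ∈ (Cset g j)ᶜ
      rw [← hOC]; exact hqO
    rw [chiC_eq_zero j hq hqC, chiC_eq_zero j h hC]

/-- `chiC` is smooth on `U ∩ V`. [folklore] -/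
theorem contMDiffAt_chiC (j : ℕ) {p : Base g} (h : p ∈ coverU g ∩ coverV g) :
    ContMDiffAt (𝓡∂ 4) 𝓘(ℝ, ℝ) ∞ (chiC g j) p :=
  contMDiffAt_const.congr_of_eventuallyEq (eventually_chiC_eq j h)

/-! ### The real lifts `FU`, `FV` -/

/-- **The lift on `U`**: `FU = rhoV · chiC`. [cite: BottTu1982Forms, §2 Prop. 2.3] -/
def FU (g j : ℕ) (p : Base g) : ℝ := rhoV p * chiC g j p

/-- **The lift on `V`**: `FV = (rhoV − 1) · chiC = −(1 − rhoV) · chiC`. [cite: BottTu1982Forms, §2 Prop. 2.3] -/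
def FV (g j : ℕ) (p : Base g) : ℝ := (rhoV p - 1) * chiC g j p

/-- `FU − FV = chiC`, an integer-valued function. [cite: BottTu1982Forms, §2 Prop. 2.3] -/
theorem FU_sub_FV (j : ℕ) (p : Base g) : FU g j p - FV g j p = chiC g j p := by
  rw [FU, FV]; ring

/-- `FU = 0` where `Re x^{2g+1} ≥ −0.27`. [folklore] -/
theorem FU_eq_zero_of_le (j : ℕ) {p : Base g} (hp : -(27 / 100 : ℝ) ≤ rePow p) : FU g j p = 0 := by
  rw [FU, rhoV_eq_zero hp, zero_mul]

/-- `FV = 0` where `Re x^{2g+1} ≤ −0.35`. [folklore] -/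
theorem FV_eq_zero_of_le (j : ℕ) {p : Base g} (hp : rePow p ≤ -(35 / 100 : ℝ)) : FV g j p = 0 := by
  rw [FV, rhoV_eq_one hp, sub_self, zero_mul]

/-- **`FU` is smooth on `U`**: near `U ∖ V` it vanishes identically, on `U ∩ V` it is a smooth
function times a locally constant one. [folklore] -/
theorem contMDiffAt_FU (j : ℕ) {p : Base g} (hp : p ∈ coverU g) :
    ContMDiffAt (𝓡∂ 4) 𝓘(ℝ, ℝ) ∞ (FU g j) p := by
  by_cases hre : -(27 / 100 : ℝ) < rePow p
  · have hev : FU g j =ᶠ[𝓝 p] fun _ => (0 : ℝ) := by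
      filter_upwards [(isOpen_lt continuous_const (continuous_rePow g)).mem_nhds hre] with q hq
      exact FU_eq_zero_of_le j (le_of_lt hq)
    exact contMDiffAt_const.congr_of_eventuallyEq hev
  · have hV : p ∈ coverV g := by
      rw [mem_coverV_iff]; push Not at hre; linarith
    exact (contMDiff_rhoV g p).mul (contMDiffAt_chiC j ⟨hp, hV⟩)

/-- **`FV` is smooth on `V`.** [folklore] -/
theorem contMDiffAt_FV (j : ℕ) {p : Base g} (hp : p ∈ coverV g) :
    ContMDiffAt (𝓡∂ 4) 𝓘(ℝ, ℝ) ∞ (FV g j) p := by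
  by_cases hre : rePow p < -(35 / 100 : ℝ)
  · have hev : FV g j =ᶠ[𝓝 p] fun _ => (0 : ℝ) := by
      filter_upwards [(isOpen_lt (continuous_rePow g) continuous_const).mem_nhds hre] with q hq
      exact FV_eq_zero_of_le j (le_of_lt hq)
    exact contMDiffAt_const.congr_of_eventuallyEq hev
  · have hU : p ∈ coverU g := by
      rw [mem_coverU_iff]; push Not at hre; linarith
    exact ((contMDiff_rhoV g p).sub contMDiffAt_const).mul (contMDiffAt_chiC j ⟨hU, hp⟩)

/-- `FU` is smooth on `U`. [folklore] -/
theorem contMDiffOn_FU (j : ℕ) : ContMDiffOn (𝓡∂ 4) 𝓘(ℝ, ℝ) ∞ (FU g j) (coverU g) :=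
  fun _ hp => (contMDiffAt_FU j hp).contMDiffWithinAt

/-- `FV` is smooth on `V`. [folklore] -/
theorem contMDiffOn_FV (j : ℕ) : ContMDiffOn (𝓡∂ 4) 𝓘(ℝ, ℝ) ∞ (FV g j) (coverV g) :=
  fun _ hp => (contMDiffAt_FV j hp).contMDiffWithinAt

/-- `FU` is continuous on `U`. [folklore] -/
theorem continuousOn_FU (j : ℕ) : ContinuousOn (FU g j) (coverU g) :=
  (contMDiffOn_FU j).continuousOn

/-- `FV` is continuous on `V`. [folklore] -/
theorem continuousOn_FV (j : ℕ) : ContinuousOn (FV g j) (coverV g) :=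
  (contMDiffOn_FV j).continuousOn

/-- `FU mod 1 = FV mod 1` (everywhere: their difference is the integer `chiC`). [cite: BottTu1982Forms, §2 Prop. 2.3] -/
theorem coe_FU_eq_coe_FV (j : ℕ) (p : Base g) :
    ((FU g j p : ℝ) : UnitAddCircle) = ((FV g j p : ℝ) : UnitAddCircle) := by
  obtain ⟨k, hk⟩ := exists_int_chiC (g := g) j p
  have e : FU g j p = FV g j p + k := by rw [← hk, ← FU_sub_FV]; ring
  rw [e, coe_add_intCast]

/-! ### The circle-valued map `phi g j` -/

/-- The underlying function of `phi`: `FU mod 1` on `U`, `FV mod 1` elsewhere. [cite: BottTu1982Forms, §2 Prop. 2.3] -/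
def phiFun (g j : ℕ) (p : Base g) : UnitAddCircle := by
  classical
  exact if p ∈ coverU g then ((FU g j p : ℝ) : UnitAddCircle) else ((FV g j p : ℝ) : UnitAddCircle)

/-- `phiFun = FU mod 1` on `U`. [folklore] -/
theorem phiFun_eq_coe_FU (j : ℕ) {p : Base g} (hp : p ∈ coverU g) :
    phiFun g j p = ((FU g j p : ℝ) : UnitAddCircle) := by
  classical
  exact if_pos hp

/-- `phiFun = FV mod 1` everywhere (hence on `V`). [folklore] -/
theorem phiFun_eq_coe_FV (j : ℕ) (p : Base g) : phiFun g j p = ((FV g j p : ℝ) : UnitAddCircle) := by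
  classical
  by_cases hp : p ∈ coverU g
  · rw [phiFun_eq_coe_FU j hp, coe_FU_eq_coe_FV]
  · exact if_neg hp

/-- `phiFun` is continuous (it is `FU mod 1` on the open `U` and `FV mod 1` on the open `V`).
[cite: BottTu1982Forms, §2 Prop. 2.3] -/
theorem continuous_phiFun (j : ℕ) : Continuous (phiFun g j) := by
  rw [continuous_iff_continuousAt]
  intro p
  have hcov : p ∈ coverU g ∪ coverV g := by rw [coverU_union_coverV]; exact mem_univ p
  rcases hcov with hU | hV
  · have hc : ContinuousAt (fun q => ((FU g j q : ℝ) : UnitAddCircle)) p :=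
      (continuous_quotient_mk'.continuousAt).comp ((contMDiffAt_FU j hU).continuousAt)
    refine hc.congr_of_eventuallyEq ?_
    filter_upwards [(isOpen_coverU g).mem_nhds hU] with q hq
    exact phiFun_eq_coe_FU j hq
  · have hc : ContinuousAt (fun q => ((FV g j q : ℝ) : UnitAddCircle)) p :=
      (continuous_quotient_mk'.continuousAt).comp ((contMDiffAt_FV j hV).continuousAt)
    exact hc.congr_of_eventuallyEq (Eventually.of_forall fun q => phiFun_eq_coe_FV j q)

/-- **The circle-valued map `phi g j : Base g → ℝ/ℤ` of the clopen set `C_j`** (the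
Mayer–Vietoris coboundary of `1_{C_j}` realised as a map to `K(ℤ, 1) = S¹`). [cite: BottTu1982Forms, §2 Prop. 2.3] -/
def phi (g j : ℕ) : C(Base g, UnitAddCircle) := ⟨phiFun g j, continuous_phiFun j⟩

/-- `phi = FU mod 1` on `U`. [cite: BottTu1982Forms, §2 Prop. 2.3] -/
theorem phi_eq_coe_FU (j : ℕ) {p : Base g} (hp : p ∈ coverU g) :
    phi g j p = ((FU g j p : ℝ) : UnitAddCircle) :=
  phiFun_eq_coe_FU j hp

/-- `phi = FV mod 1` on `V` (indeed everywhere). [cite: BottTu1982Forms, §2 Prop. 2.3] -/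
theorem phi_eq_coe_FV (j : ℕ) {p : Base g} (_hp : p ∈ coverV g) :
    phi g j p = ((FV g j p : ℝ) : UnitAddCircle) :=
  phiFun_eq_coe_FV j p

/-- **`phi` has smooth local real lifts**: every point has a neighbourhood on which
`phi = F mod 1` for a function `F` smooth at the points of that neighbourhood (namely `FU` on `U`,
`FV` on `V`). [cite: BottTu1982Forms, §2 Prop. 2.3] -/
theorem exists_smooth_lift_phi (j : ℕ) (p : Base g) :
    ∃ (W : Set (Base g)) (F : Base g → ℝ), IsOpen W ∧ p ∈ W ∧
      (∀ q ∈ W, ContMDiffAt (𝓡∂ 4) 𝓘(ℝ, ℝ) ∞ F q) ∧ ∀ q ∈ W, phi g j q = ((F q : ℝ) : UnitAddCircle) := by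
  have hcov : p ∈ coverU g ∪ coverV g := by rw [coverU_union_coverV]; exact mem_univ p
  rcases hcov with hU | hV
  · exact ⟨coverU g, FU g j, isOpen_coverU g, hU, fun q hq => contMDiffAt_FU j hq,
      fun q hq => phi_eq_coe_FU j hq⟩
  · exact ⟨coverV g, FV g j, isOpen_coverV g, hV, fun q hq => contMDiffAt_FV j hq,
      fun q hq => phi_eq_coe_FV j hq⟩

end LefschetzBase

end Literature.Topology.FourManifolds
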